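import Mathlib.RingTheory.AlgebraicIndependent.Transcendental
import Mathlib.FieldTheory.IntermediateField.Adjoin.Basic
import Mathlib.Analysis.Analytic.Polynomial
import Mathlib.Analysis.Calculus.ContDiff.RCLike
import Mathlib.Analysis.Complex.Polynomial.Basic
import Mathlib.Algebra.MvPolynomial.Equiv

/-!
# Lifting step for the approximation property — roots (stub `stub_lift`, part 1)

Route `DiophantineDichotomy`, crux `ApproximationProperty` (stmt-Schanuel-6117), line
`orbit-interpolation-determinant`, registered stub `stub_lift`
(`(∀ t₀ ∈ [1, t], PointAPAbsAt t₀) → PointwiseAPSlice t`).  This first part is pure algebra and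
analysis over `ℂ`, with no heights:

* `exists_algIndep_basis` — a transcendence basis INSIDE a finite generating tuple: for
  `θ : ι → ℂ` with `trdeg_ℚ ℚ(θ) ≤ t` there are `t₀ ≤ t` and an algebraically independent
  `ω : Fin t₀ → ℂ` (a sub-tuple of `θ`) over which every coordinate `θ i` is algebraic, in the
  form `¬ AlgebraicIndependent ℚ (θ i, ω)`;
* `eval_map_optionEquivLeft` — the evaluation rule for `MvPolynomial.optionEquivLeft`;
* `exists_near_root` — ELEMENTARY ROOT PERTURBATION with a Hölder loss: if `ω` is algebraically
  independent and `η` is algebraic over `ℚ(ω)`, there is `P ∈ ℚ[x₁, …, x_{t₀}][y]` of degree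
  `e ≥ 1` in `y` and `r, L > 0` such that for every `z` with `‖z - ω‖ ≤ r` the leading
  coefficient of `P(z, ·)` does not vanish and `P(z, ·)` has a complex root `y` with
  `‖y - η‖ ^ e ≤ L ‖z - ω‖` (`P(z, η)` is Lipschitz in `z` near `ω`, `P(ω, η) = 0`, and
  `|P(z, η)| = |a(z)| ∏ |η - yⱼ(z)|`).

No new definitions; every theorem is proved.  Sources: NesterenkoPhilippon2001 (LNM 1752)
Ch. 4 §4; folklore.
-/

-- `Summit.Schanuel.Schanuel.…` is the mandated summit/sub-problem namespace (single-conjunct summit), hence: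
set_option linter.dupNamespace false

namespace Summit.Schanuel.Schanuel.Cruxes.ApproximationProperty.OrbitInterpolationDeterminant

open Polynomial

noncomputable section

/-! ## A transcendence basis inside a finite generating tuple -/

/-- **A transcendence basis among the coordinates.** If `trdeg_ℚ ℚ(θ) ≤ t` for a finite tuple
`θ : ι → ℂ`, then there are `t₀ ≤ t` and an algebraically independent sub-tuple
`ω : Fin t₀ → ℂ` of `θ` such that no coordinate `θ i` extends `ω` to an algebraically independent
family (i.e. every `θ i` is algebraic over `ℚ(ω)`). [folklore] -/
theorem exists_algIndep_basis {ι : Type} [Fintype ι] (θ : ι → ℂ) {t : ℕ}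
    (ht : Algebra.trdeg ℚ ↥(IntermediateField.adjoin ℚ (Set.range θ)) ≤ (t : Cardinal)) :
    ∃ t₀ : ℕ, t₀ ≤ t ∧ ∃ ω : Fin t₀ → ℂ, AlgebraicIndependent ℚ ω ∧ (∀ k, ω k ∈ Set.range θ) ∧
      ∀ i, ¬ AlgebraicIndependent ℚ (fun o : Option (Fin t₀) => o.elim (θ i) ω) := by
  classical
  set good : Finset (Finset ι) := Finset.univ.filter
    (fun s : Finset ι => AlgebraicIndependent ℚ (fun k : ↥s => θ k)) with hgood
  have hne : good.Nonempty := by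
    refine ⟨∅, ?_⟩
    rw [hgood, Finset.mem_filter]
    refine ⟨Finset.mem_univ _, ?_⟩
    rw [algebraicIndependent_empty_type_iff]
    exact (algebraMap ℚ ℂ).injective
  obtain ⟨s, hs, hmax⟩ := Finset.exists_max_image good Finset.card hne
  have hsind : AlgebraicIndependent ℚ (fun k : ↥s => θ k) := (Finset.mem_filter.mp hs).2
  set e : Fin s.card ≃ ↥s := s.equivFin.symm with he
  refine ⟨s.card, ?_, fun k => θ (e k), hsind.comp e e.injective, fun k => ⟨(e k : ι), rfl⟩, ?_⟩
  · -- `#s ≤ trdeg ≤ t`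
    have hmem : ∀ k : ↥s, θ k ∈ IntermediateField.adjoin ℚ (Set.range θ) := fun k =>
      IntermediateField.subset_adjoin ℚ _ ⟨k, rfl⟩
    have hx : AlgebraicIndependent ℚ
        (fun k : ↥s => (⟨θ k, hmem k⟩ : ↥(IntermediateField.adjoin ℚ (Set.range θ)))) :=
      AlgebraicIndependent.of_comp (IntermediateField.adjoin ℚ (Set.range θ)).val hsind
    have h1 := hx.cardinalMk_le_trdeg
    rw [Cardinal.mk_fintype, Fintype.card_coe] at h1
    exact_mod_cast h1.trans ht
  · intro i hi
    by_cases his : i ∈ s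
    · have h : (none : Option (Fin s.card)) = some (e.symm ⟨i, his⟩) := hi.injective (by simp)
      exact absurd h (Option.some_ne_none _).symm
    · set g : ↥(insert i s) → Option (Fin s.card) := fun j =>
        if h : (j : ι) ∈ s then some (e.symm ⟨j, h⟩) else none with hg
      have hji : ∀ j : ↥(insert i s), (j : ι) ∉ s → (j : ι) = i := fun j hj => by
        rcases Finset.mem_insert.mp j.2 with h | h
        · exact h
        · exact absurd h hj
      have hcomp : (fun o : Option (Fin s.card) => o.elim (θ i) (fun k => θ (e k))) ∘ g =
          fun j : ↥(insert i s) => θ j := by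
        funext j
        by_cases h : (j : ι) ∈ s
        · simp [hg, h]
        · simp [hg, hji j h, his]
      have hginj : Function.Injective g := by
        intro a b hab
        by_cases ha : (a : ι) ∈ s <;> by_cases hb : (b : ι) ∈ s
        · simp only [hg, ha, hb, dite_true, Option.some.injEq, Equiv.apply_eq_iff_eq,
            Subtype.mk.injEq] at hab
          exact Subtype.ext hab
        · simp [hg, ha, hb] at hab
        · simp [hg, ha, hb] at hab
        · exact Subtype.ext ((hji a ha).trans (hji b hb).symm)
      have hind' : AlgebraicIndependent ℚ (fun j : ↥(insert i s) => θ j) := by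
        rw [← hcomp]
        exact hi.comp g hginj
      have hmem : insert i s ∈ good := by
        rw [hgood, Finset.mem_filter]
        exact ⟨Finset.mem_univ _, hind'⟩
      have := hmax _ hmem
      rw [Finset.card_insert_of_notMem his] at this
      omega

/-! ## Evaluating `optionEquivLeft` -/

/-- The evaluation rule for `MvPolynomial.optionEquivLeft`: viewing `f ∈ R[x_o : o ∈ Option σ]`
as a polynomial in `y = x_none` over `R[x_σ]`, specialising `x_σ ↦ z` and then `y ↦ y₀` is the
evaluation of `f` at `(y₀, z)`. [folklore] -/
theorem eval_map_optionEquivLeft {R A σ : Type*} [CommSemiring R] [CommSemiring A] [Algebra R A]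
    (f : MvPolynomial (Option σ) R) (z : σ → A) (y : A) :
    ((MvPolynomial.optionEquivLeft R σ f).map (MvPolynomial.aeval z).toRingHom).eval y =
      MvPolynomial.aeval (fun o : Option σ => o.elim y z) f := by
  induction f using MvPolynomial.induction_on with
  | C a =>
    simp [MvPolynomial.optionEquivLeft_C]
  | add p q hp hq =>
    rw [map_add, Polynomial.map_add, Polynomial.eval_add, map_add, hp, hq]
  | mul_X p o hp =>
    rw [map_mul, Polynomial.map_mul, Polynomial.eval_mul, map_mul, hp]
    cases o with
    | none =>
      rw [MvPolynomial.optionEquivLeft_X_none, Polynomial.map_X, Polynomial.eval_X,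
        MvPolynomial.aeval_X]
      rfl
    | some k =>
      rw [MvPolynomial.optionEquivLeft_X_some, Polynomial.map_C, Polynomial.eval_C,
        MvPolynomial.aeval_X, AlgHom.toRingHom_eq_coe, RingHom.coe_coe, MvPolynomial.aeval_X]
      rfl

/-! ## Elementary root perturbation -/

/-- **Root perturbation with a Hölder loss.** Let `ω : Fin n → ℂ` be algebraically independent
over `ℚ` and let `η ∈ ℂ` be algebraic over `ℚ(ω)` (stated as: `(η, ω)` is algebraically
dependent).  Then there are `P ∈ ℚ[x₁, …, xₙ][y]` of degree `e ≥ 1` in `y` and `r, L > 0` such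
that for every `z` with `‖z - ω‖ ≤ r`, the leading coefficient of `P` does not vanish at `z` and
`P(z, ·)` has a complex root `y` with `‖y - η‖ ^ e ≤ L ‖z - ω‖`.  (No implicit function theorem:
`|P(z, η)| = |P(z, η) - P(ω, η)| ≤ K ‖z - ω‖` by local Lipschitz continuity, `|a(z)| ≥ |a(ω)|/2`
by continuity, and `|P(z, η)| = |a(z)| ∏ⱼ |η - yⱼ(z)| ≥ |a(z)| minⱼ |η - yⱼ(z)| ^ e`.)
[folklore] -/
theorem exists_near_root {n : ℕ} {ω : Fin n → ℂ} (hω : AlgebraicIndependent ℚ ω) {η : ℂ}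
    (hη : ¬ AlgebraicIndependent ℚ (fun o : Option (Fin n) => o.elim η ω)) :
    ∃ (P : Polynomial (MvPolynomial (Fin n) ℚ)) (r L : ℝ), 0 < r ∧ 0 < L ∧ 0 < P.natDegree ∧
      ∀ z : Fin n → ℂ, ‖z - ω‖ ≤ r →
        MvPolynomial.aeval z P.leadingCoeff ≠ 0 ∧
        ∃ y : ℂ, (P.map (MvPolynomial.aeval z).toRingHom).IsRoot y ∧
          ‖y - η‖ ^ P.natDegree ≤ L * ‖z - ω‖ := by
  classical
  -- a non-trivial algebraic relation between `η` and `ω`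
  have hrel : ∃ R : MvPolynomial (Option (Fin n)) ℚ, R ≠ 0 ∧
      MvPolynomial.aeval (fun o : Option (Fin n) => o.elim η ω) R = 0 := by
    by_contra h
    push Not at h
    apply hη
    change Function.Injective (MvPolynomial.aeval (fun o : Option (Fin n) => o.elim η ω))
    rw [injective_iff_map_eq_zero]
    intro R hR
    by_contra hR0
    exact h R hR0 hR
  obtain ⟨R, hR0, hRη⟩ := hrel
  set P := MvPolynomial.optionEquivLeft ℚ (Fin n) R with hP
  have hP0 : P ≠ 0 := by
    rw [hP]
    exact (EmbeddingLike.map_ne_zero_iff (f := MvPolynomial.optionEquivLeft ℚ (Fin n))).mpr hR0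
  have heval : ∀ (z : Fin n → ℂ) (y : ℂ), (P.map (MvPolynomial.aeval z).toRingHom).eval y =
      MvPolynomial.aeval (fun o : Option (Fin n) => o.elim y z) R := fun z y =>
    eval_map_optionEquivLeft R z y
  set a := P.leadingCoeff with ha
  have ha0 : a ≠ 0 := leadingCoeff_ne_zero.mpr hP0
  have haω : MvPolynomial.aeval ω a ≠ 0 := by
    intro h
    apply ha0
    exact hω (by rw [h, map_zero])
  set e := P.natDegree with he
  have he0 : 0 < e := by
    by_contra h0
    have h0' : P.natDegree = 0 := by omega
    have hPC : P = Polynomial.C a := by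
      rw [ha, Polynomial.leadingCoeff, h0']
      exact Polynomial.eq_C_of_natDegree_eq_zero h0'
    have h1 := heval ω η
    rw [hRη, hPC, Polynomial.map_C, Polynomial.eval_C] at h1
    exact haω h1
  -- the two polynomial functions of `z`
  set F : (Fin n → ℂ) → ℂ := fun z =>
    MvPolynomial.aeval (fun o : Option (Fin n) => o.elim η z) R with hF
  set G : (Fin n → ℂ) → ℂ := fun z => MvPolynomial.aeval z a with hG
  have hFω : F ω = 0 := hRη
  have hproj : ∀ k : Fin n, AnalyticAt ℂ (fun z : Fin n → ℂ => z k) ω := fun k =>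
    ((ContinuousLinearMap.proj (R := ℂ) (φ := fun _ : Fin n => ℂ) k).analyticAt ω).congr
      (Filter.Eventually.of_forall fun _ => rfl)
  have hFan : AnalyticAt ℂ F ω := by
    refine AnalyticAt.aeval_mvPolynomial
      (f := fun (z : Fin n → ℂ) (o : Option (Fin n)) => o.elim η z) ?_ R
    intro o
    cases o with
    | none => exact analyticAt_const
    | some k => exact hproj k
  have hGan : AnalyticAt ℂ G ω :=
    AnalyticAt.aeval_mvPolynomial (f := fun (z : Fin n → ℂ) (k : Fin n) => z k) hproj a
  obtain ⟨K₁, s, hs, hLip⟩ := (hFan.contDiffAt (n := 1)).exists_lipschitzOnWith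
  obtain ⟨ε, hε, hball⟩ := Metric.mem_nhds_iff.mp hs
  have hGω : 0 < ‖G ω‖ := norm_pos_iff.mpr haω
  obtain ⟨δ, hδ, hGδ⟩ := Metric.continuousAt_iff.mp hGan.continuousAt (‖G ω‖ / 2) (half_pos hGω)
  set r := min (ε / 2) (δ / 2) with hr
  have hr0 : 0 < r := lt_min (half_pos hε) (half_pos hδ)
  set L := 2 * ((K₁ : ℝ) + 1) / ‖G ω‖ with hL
  have hL0 : 0 < L := by positivity
  refine ⟨P, r, L, hr0, hL0, he0, fun z hz => ?_⟩
  have hzε : z ∈ Metric.ball ω ε := by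
    rw [Metric.mem_ball, dist_eq_norm]
    linarith [min_le_left (ε / 2) (δ / 2)]
  have hzδ : dist z ω < δ := by
    rw [dist_eq_norm]
    linarith [min_le_right (ε / 2) (δ / 2)]
  -- `‖G z‖ ≥ ‖G ω‖ / 2`
  have hGz : ‖G ω‖ / 2 ≤ ‖G z‖ := by
    have h := hGδ hzδ
    rw [dist_eq_norm] at h
    have h2 := norm_sub_norm_le (G ω) (G z)
    rw [← norm_neg (G ω - G z), neg_sub] at h2
    linarith
  have hGz0 : G z ≠ 0 := by
    intro h
    rw [h, norm_zero] at hGz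
    linarith
  -- `‖F z‖ ≤ K₁ ‖z - ω‖`
  have hFz : ‖F z‖ ≤ K₁ * ‖z - ω‖ := by
    have h := hLip.norm_sub_le (hball hzε) (hball (Metric.mem_ball_self hε))
    rwa [hFω, sub_zero] at h
  -- the specialised polynomial `P(z, ·)`
  set Pz := P.map (MvPolynomial.aeval z).toRingHom with hPz
  have hlc : Pz.leadingCoeff = G z := by
    rw [hPz, Polynomial.leadingCoeff_map_of_leadingCoeff_ne_zero _ hGz0]
    rfl
  have hdeg : Pz.natDegree = e := by
    rw [hPz, Polynomial.natDegree_map_of_leadingCoeff_ne_zero _ hGz0]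
  have hsplit : Pz.Splits := IsAlgClosed.splits Pz
  have hcard : Pz.roots.card = e := by rw [← hdeg, hsplit.natDegree_eq_card_roots]
  have hne : Pz.roots.toFinset.Nonempty := by
    rw [Multiset.toFinset_nonempty]
    intro h0
    rw [h0, Multiset.card_zero] at hcard
    omega
  obtain ⟨ρ, hρ, hmin⟩ := Finset.exists_min_image Pz.roots.toFinset (fun ρ => ‖η - ρ‖) hne
  refine ⟨hGz0, ρ, isRoot_of_mem_roots (Multiset.mem_toFinset.mp hρ), ?_⟩
  -- `‖η - ρ‖ ^ e * ‖G z‖ ≤ ‖F z‖`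
  have hprod : ‖η - ρ‖ ^ e ≤ (Pz.roots.map fun ρ' => ‖η - ρ'‖).prod := by
    have h1 : (Pz.roots.map fun _ => ‖η - ρ‖).prod = ‖η - ρ‖ ^ e := by
      rw [Multiset.map_const', Multiset.prod_replicate, hcard]
    rw [← h1]
    exact Multiset.prod_map_le_prod_map₀ _ _ (fun _ _ => norm_nonneg _)
      (fun ρ' hρ' => hmin ρ' (Multiset.mem_toFinset.mpr hρ'))
  have hnorm : ‖F z‖ = ‖G z‖ * (Pz.roots.map fun ρ' => ‖η - ρ'‖).prod := by
    have h1 : F z = Pz.eval η := (heval z η).symm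
    rw [h1, hsplit.eval_eq_prod_roots, norm_mul, hlc]
    congr 1
    have h2 := map_multiset_prod (normHom : ℂ →*₀ ℝ) (Pz.roots.map fun ρ' => η - ρ')
    rw [Multiset.map_map] at h2
    simpa using h2
  have hprod0 : 0 ≤ (Pz.roots.map fun ρ' => ‖η - ρ'‖).prod :=
    Multiset.prod_nonneg fun x hx => by
      obtain ⟨ρ', -, rfl⟩ := Multiset.mem_map.mp hx
      exact norm_nonneg _
  have hmain : ‖η - ρ‖ ^ e * (‖G ω‖ / 2) ≤ ((K₁ : ℝ) + 1) * ‖z - ω‖ := by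
    calc ‖η - ρ‖ ^ e * (‖G ω‖ / 2) ≤ (Pz.roots.map fun ρ' => ‖η - ρ'‖).prod * ‖G z‖ :=
          mul_le_mul hprod hGz (by positivity) hprod0
      _ = ‖F z‖ := by rw [hnorm, mul_comm]
      _ ≤ K₁ * ‖z - ω‖ := hFz
      _ ≤ ((K₁ : ℝ) + 1) * ‖z - ω‖ := by
          gcongr
          linarith
  rw [norm_sub_rev, hL, div_mul_eq_mul_div, le_div_iff₀ hGω]
  linarith

/-! ## The registered sub-goal of this file -/

/-- REGISTERED SUB-GOAL `stub_lift_roots` of stub `stub_lift` (crux stmt-Schanuel-6117; this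
helper file's deliverable, in the registered `∀`-chain shape): (1) a transcendence basis INSIDE a
finite generating tuple of `ℂ` over `ℚ`; (2) root perturbation with a Hölder loss for a complex
number algebraic over an algebraically independent tuple. -/
theorem stub_lift_roots :
    (∀ (ι : Type) [Fintype ι] (θ : ι → ℂ) (t : ℕ),
      Algebra.trdeg ℚ ↥(IntermediateField.adjoin ℚ (Set.range θ)) ≤ (t : Cardinal) →
      ∃ t₀ : ℕ, t₀ ≤ t ∧ ∃ ω : Fin t₀ → ℂ, AlgebraicIndependent ℚ ω ∧ (∀ k, ω k ∈ Set.range θ) ∧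
        ∀ i, ¬ AlgebraicIndependent ℚ (fun o : Option (Fin t₀) => o.elim (θ i) ω)) ∧
    (∀ (n : ℕ) (ω : Fin n → ℂ) (η : ℂ), AlgebraicIndependent ℚ ω →
      ¬ AlgebraicIndependent ℚ (fun o : Option (Fin n) => o.elim η ω) →
      ∃ (P : Polynomial (MvPolynomial (Fin n) ℚ)) (r L : ℝ), 0 < r ∧ 0 < L ∧ 0 < P.natDegree ∧
        ∀ z : Fin n → ℂ, ‖z - ω‖ ≤ r → MvPolynomial.aeval z P.leadingCoeff ≠ 0 ∧
          ∃ y : ℂ, (P.map (MvPolynomial.aeval z).toRingHom).IsRoot y ∧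
            ‖y - η‖ ^ P.natDegree ≤ L * ‖z - ω‖) :=
  ⟨fun _ _ θ _ ht => exists_algIndep_basis θ ht, fun _ _ _ hω hη => exists_near_root hω hη⟩

end

end Summit.Schanuel.Schanuel.Cruxes.ApproximationProperty.OrbitInterpolationDeterminant
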